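import Summits.SmoothPoincare4.SmoothPoincare4.Theses.ThreePointSpheres
import Literature.Topology.FourManifolds.HCobordismHandlesProofs
import Literature.Topology.FourManifolds.HomotopyS4CompactProofs
import Literature.Topology.FourManifolds.SphereSimplyConnected
import Literature.Topology.FourManifolds.HomotopyS4OrientableProofs
import Literature.Topology.FourManifolds.ThetaFour
import Literature.Topology.FourManifolds.CorkDecompositionMiddleLevel

/-!
# Line `birth` — BC3 skeleton for the crux `SpherePresentation` (stmt-SmoothPoincare4-11167)

Route `ThreePointSpheres` (route-SmoothPoincare4-ThreePointSpheres, crux rank 2 = the route's FACT-GATE),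
skeleton registrar planner-skel-stmt-SmoothPoincare4-11167-0, 2026-08-17.

The crux (`Summit.SmoothPoincare4.SmoothPoincare4.Theses.ThreePointSpheres.SpherePresentation`): every
smooth homotopy 4-sphere `M ≃ₕ S⁴` (the Statement's own binders: `M : Type`, Hausdorff, second
countable, `C^∞` atlas modelled on `ℝ⁴`) admits an ALGEBRAICALLY DUAL MIDDLE-LEVEL PRESENTATION FROM
`S⁴`: a closed simply connected smooth `N`, orientations, `k`, framed families `S`, `P` of `k` disjoint
2-spheres in `N`, algebraically dual (`Sᵢ · Pⱼ = δᵢⱼ`), with `S⁴` obtained from `N` by surgery along `P`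
and `M` by surgery along `S`.

## The line = Smale's transferable steps, typed (the route docstring's own plan for this item)

`SpherePresentation ⇐ Θ₄ = 0 (h-cobordism form) + two-three handle trading + middle level (B)`.
Two registered stubs — the two UNPROVED named facts of the tree this fact-gate rests on, in
bare-binder, `S⁴`-first form — and everything else PROVED in the composition:

* `stub_thetaFour_bare` (Kervaire–Milnor 1963, `Θ₄ = 0` as h-cobordism classes: table p. 504 via
  Thm. 5.1, §4 and Lemma 2.3; Wall 1964 Thms. 2–3). Every compact smooth `M ≃ₕ S⁴` is smoothly
  h-cobordant FROM the standard `S⁴` (`IsHCobordant 4 𝕊⁴ M`). Fact-level: it is the tree's named fact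
  `isHCobordant_sphere_of_homotopySphere_four` (UNPROVED; 4 open leaves in
  `ThetaFourKervaireMilnor.lean`) after packaging `M` as a `HomotopySphere 4` (orientation by the
  PROVED `isOrientable_of_homotopyEquiv_sphere_four_holds`) and `IsHCobordant.symm` (proved) —
  `stub_thetaFour_bare_of_fact` below, sorry-free.
* `stub_middleLevel_fromSphere` (Kirby 1996 §2 last paragraph; Matveyev 1996, Proof of Theorem,
  sentences 1–6; Milnor 1965 Def. 3.11/Thm. 3.13, §3 p. 21, Thm. 7.6 with Cor. 7.3/Thm. 7.4). A
  two-three Morse function on an h-cobordism `S⁴ ~ M` (`M` closed simply connected) yields the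
  algebraically dual middle-level presentation (`N`, `oN`, `oS`, `oP`, `k`, `S`, `P`) with
  `P.IsSurgery S⁴`, `S.IsSurgery M`. Fact-level: it is the tree's named fact (B)
  `exists_dualSpheres_middleLevel_of_two_three.{0}` at `X₁ = S⁴`, `X₂ = M` with the level-embedding
  clause dropped — `stub_middleLevel_fromSphere_of_fact` below, sorry-free. LOAD-BEARING / hardest
  (5-dimensional handle theory read on the middle level: regular levels as closed manifolds, handle
  spheres with product neighbourhoods, Milnor's basis theorem 7.6).

`SpherePresentation_of : Sig.stub_thetaFour_bare → Sig.stub_middleLevel_fromSphere → SpherePresentation`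
is the REAL composition (sorry-free): `M` is compact (`compactSpace_of_homotopyEquiv_sphere_four_holds`,
Hatcher 3.29, PROVED) and simply connected (`simplyConnectedSpace_sphere_four_holds` + transport along
`e`, PROVED); stub 1 gives an h-cobordism `c : S⁴ ~ M`; two-three handle trading in the 5-dimensional
h-cobordism is PROVED in the tree (`exists_isMorseFunction_two_three_of_isHCobordism_holds`, Milnor
Thm. 8.1 + 4.8, Freedman–Quinn proof of 7.1D); stub 2 reads off the middle level — the crux's `∃`-body
verbatim. `SpherePresentation_proof : SpherePresentation` is the skeleton in its final shape (depends on
`sorryAx` only through the two `stub_*`).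

Stub signatures are IDENTICAL to the registered stubs of the twin item stmt-SmoothPoincare4-18144
(`CommonDualRelay.SpherePresentation`, the same Prop; skeleton
`Cruxes/DualPresentation/Lines/split_presentation.lean`), so one stub proof discharges both skeletons.

## Disproof used / dead lines / negatives

`ledger crux ls stmt-SmoothPoincare4-11167`: no workfiles (no `Disproof.lean`, no earlier line) as of
2026-08-17; `ledger negatives --problem SmoothPoincare4`: 0 refuted statements. Nothing to honour or
avoid. Refuter stamps on the item (2026-08-15): the crux SURVIVES crux-attack, is non-vacuous (body
holds at `M = S⁴`, `k = 0`), is implied by the summit via the `k = 0` witness (so `¬crux` = an exotic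
`S⁴`), and a non-circular proof must use `k ≥ 1` — this line does (the `k` of stub 2 is the number of
2-handles of the two-three handlebody, not chosen by us).

## BC3 audit (this seat; raw outputs in the seat's NOTES.md `birth-certificate:`)

`lean check --json` rc 0, `sorry` exactly in `stub_thetaFour_bare` and `stub_middleLevel_fromSphere`
(sorry count 2 = stub count, zero elsewhere). Probes `stub → SpherePresentation` and
`stub → SmoothPoincare4` by `first | exact? | simpa | aesop` FAIL for both stubs (seat folder
`bc/SpherePresentation_stub_probes.lean`).
-/

set_option linter.dupNamespace false
set_option linter.unusedVariables false

noncomputable section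

namespace Summit.SmoothPoincare4.SmoothPoincare4.Cruxes.SpherePresentation.Birth

open scoped Manifold ContDiff Topology ContinuousMap
open Set Function
open Literature.Topology.FourManifolds

/-- Local notation: the round 4-sphere `S⁴ ⊂ ℝ⁵` with Mathlib's manifold structure. -/
local notation "𝕊⁴" => (Metric.sphere (0 : EuclideanSpace ℝ (Fin 5)) 1)

/-- Local notation: the round 2-sphere `S² ⊂ ℝ³` (target of the orientations `oS`, `oP`). -/
local notation "𝕊²" => (Metric.sphere (0 : EuclideanSpace ℝ (Fin 3)) 1)

/-! ### Stub signatures (`Sig.stub_*`; the registered stubs below restate them verbatim so that the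
registered signatures are self-contained over tree declarations) -/

/-- STUB 1 SIGNATURE — `Θ₄ = 0`, bare binders, direction `S⁴ → M`: every compact smooth 4-manifold
homotopy equivalent to `S⁴` is smoothly h-cobordant from the standard `S⁴`. -/
def Sig.stub_thetaFour_bare : Prop :=
  ∀ (M : Type) [TopologicalSpace M] [T2Space M] [SecondCountableTopology M]
    [ChartedSpace (EuclideanSpace ℝ (Fin 4)) M] [IsManifold (𝓡 4) ∞ M] [CompactSpace M],
    M ≃ₕ 𝕊⁴ → IsHCobordant 4 𝕊⁴ M

/-- STUB 2 SIGNATURE — THE MIDDLE LEVEL OF A TWO-THREE HANDLEBODY OF AN H-COBORDISM FROM `S⁴`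
(fact (B) at `X₁ = S⁴`, `X₂ = M`, level-embedding clause dropped). -/
def Sig.stub_middleLevel_fromSphere : Prop :=
  ∀ (M : Type) [TopologicalSpace M] [T2Space M] [SecondCountableTopology M]
    [ChartedSpace (EuclideanSpace ℝ (Fin 4)) M] [IsManifold (𝓡 4) ∞ M] [CompactSpace M]
    [SimplyConnectedSpace M] (c : Cobordism 4 𝕊⁴ M) (f : c.W → ℝ), c.IsHCobordism →
    c.IsMorseFunction f →
    (∀ z, IsMCriticalPt (𝓡∂ (4 + 1)) f z →
      morseIndex (𝓡∂ (4 + 1)) f z = 2 ∧ f z < 2⁻¹ ∨ morseIndex (𝓡∂ (4 + 1)) f z = 3 ∧ 2⁻¹ < f z) →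
    ∃ (N : Type) (_ : TopologicalSpace N) (_ : T2Space N) (_ : SecondCountableTopology N)
      (_ : ChartedSpace (EuclideanSpace ℝ (Fin 4)) N) (_ : IsManifold (𝓡 4) ∞ N) (_ : CompactSpace N)
      (_ : SimplyConnectedSpace N) (oN : SmoothOrientation (𝓡 4) N)
      (oS oP : SmoothOrientation (𝓡 2) 𝕊²) (k : ℕ) (S P : FramedSphereFamily (𝓡 4) N (Fin k) 2 2),
      IsAlgebraicallyDual (𝓡 2) (𝓡 2) (𝓡 4) two_add_two_eq_four oS oP oN S.sphere P.sphere ∧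
      P.IsSurgery (𝓡 4) 𝕊⁴ ∧ S.IsSurgery (𝓡 4) M

/-! ### Registered stubs (the ONLY `sorry`s of the file) -/

/-- **Stub 1 — `Θ₄ = 0` in h-cobordism form, bare binders, `S⁴ → M`** (Kervaire–Milnor 1963, table
p. 504, entry `n = 4 ↦ 1`, via Thm. 5.1 (p. 512), §4 (p. 512) and Lemma 2.3 (p. 506); Wall 1964,
Thms. 2–3). Why plausibly true: it IS the tree's named fact `isHCobordant_sphere_of_homotopySphere_four`
read on the Statement's binders (`stub_thetaFour_bare_of_fact`). Size: XL as Lean debt (the four open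
leaves of `ThetaFourKervaireMilnor.lean`), nil as mathematics. Sources: KervaireMilnorAnnals1963,
WallJLMS1964, MilnorHCobordism1965. -/
theorem stub_thetaFour_bare :
    ∀ (M : Type) [TopologicalSpace M] [T2Space M] [SecondCountableTopology M]
      [ChartedSpace (EuclideanSpace ℝ (Fin 4)) M] [IsManifold (𝓡 4) ∞ M] [CompactSpace M],
      M ≃ₕ (Metric.sphere (0 : EuclideanSpace ℝ (Fin 5)) 1) →
        IsHCobordant 4 (Metric.sphere (0 : EuclideanSpace ℝ (Fin 5)) 1) M := by
  sorry

/-- **Stub 2 — the middle level of a two-three handlebody of an h-cobordism from `S⁴`** (Kirby 1996,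
§2 last paragraph and §1; Matveyev 1996, Proof of Theorem, sentences 1–6; Milnor 1965, Def. 3.11,
Thm. 3.13, §3 p. 21, Thm. 7.6 with Cor. 7.3 and Thm. 7.4, Thms. 4.4/5.2, Remark 1 after Thm. 6.4).
Why plausibly true: it IS the tree's named fact (B) `exists_dualSpheres_middleLevel_of_two_three.{0}`
at `X₁ = S⁴`, `X₂ = M` minus its level-embedding clause (`stub_middleLevel_fromSphere_of_fact`). Size:
XL (5-dimensional handle theory read on the middle level; fact seat
provefact-Literature.Topology.FourManifolds.corkDecomposition). LOAD-BEARING. Sources: KirbyCorks1996,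
Matveyev1996, MilnorHCobordism1965. -/
theorem stub_middleLevel_fromSphere :
    ∀ (M : Type) [TopologicalSpace M] [T2Space M] [SecondCountableTopology M]
      [ChartedSpace (EuclideanSpace ℝ (Fin 4)) M] [IsManifold (𝓡 4) ∞ M] [CompactSpace M]
      [SimplyConnectedSpace M] (c : Cobordism 4 (Metric.sphere (0 : EuclideanSpace ℝ (Fin 5)) 1) M)
      (f : c.W → ℝ), c.IsHCobordism → c.IsMorseFunction f →
      (∀ z, IsMCriticalPt (𝓡∂ (4 + 1)) f z →
        morseIndex (𝓡∂ (4 + 1)) f z = 2 ∧ f z < 2⁻¹ ∨ morseIndex (𝓡∂ (4 + 1)) f z = 3 ∧ 2⁻¹ < f z) →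
      ∃ (N : Type) (_ : TopologicalSpace N) (_ : T2Space N) (_ : SecondCountableTopology N)
        (_ : ChartedSpace (EuclideanSpace ℝ (Fin 4)) N) (_ : IsManifold (𝓡 4) ∞ N) (_ : CompactSpace N)
        (_ : SimplyConnectedSpace N) (oN : SmoothOrientation (𝓡 4) N)
        (oS oP : SmoothOrientation (𝓡 2) (Metric.sphere (0 : EuclideanSpace ℝ (Fin 3)) 1)) (k : ℕ)
        (S P : FramedSphereFamily (𝓡 4) N (Fin k) 2 2),
        IsAlgebraicallyDual (𝓡 2) (𝓡 2) (𝓡 4) two_add_two_eq_four oS oP oN S.sphere P.sphere ∧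
        P.IsSurgery (𝓡 4) (Metric.sphere (0 : EuclideanSpace ℝ (Fin 5)) 1) ∧ S.IsSurgery (𝓡 4) M := by
  sorry

/-! ### Sorry-free certificates: both stubs are fact-level (each is one UNPROVED named fact of the tree) -/

/-- The registered stub 1 is, up to unfolding, `Sig.stub_thetaFour_bare`. [bookkeeping] -/
theorem sig_stub_thetaFour_bare : Sig.stub_thetaFour_bare := stub_thetaFour_bare

/-- The registered stub 2 is, up to unfolding, `Sig.stub_middleLevel_fromSphere`. [bookkeeping] -/
theorem sig_stub_middleLevel_fromSphere : Sig.stub_middleLevel_fromSphere := stub_middleLevel_fromSphere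

/-- **Stub 1 from the tree's named fact `Θ₄ = 0`** (sorry-free): package `M` with a chosen orientation
(`isOrientable_of_homotopyEquiv_sphere_four_holds`, Lee Thm. 15.43, PROVED) as a `HomotopySphere 4`,
apply `isHCobordant_sphere_of_homotopySphere_four` and reverse the h-cobordism (`IsHCobordant.symm`).
[cite: KervaireMilnorAnnals1963, table p. 504 via Thm. 5.1, §4 (p. 512) and Lemma 2.3 (p. 506)] -/
theorem stub_thetaFour_bare_of_fact (hΘ : isHCobordant_sphere_of_homotopySphere_four) :
    Sig.stub_thetaFour_bare := by
  intro M _ _ _ _ _ _ e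
  let Q : HomotopySphere 4 :=
    { carrier := M
      orientation := Classical.choice (isOrientable_of_homotopyEquiv_sphere_four_holds M e)
      nonempty_homotopyEquiv := ⟨e⟩ }
  have hc : IsHCobordant 4 M 𝕊⁴ := hΘ Q
  exact hc.symm

/-- **Stub 2 from the tree's named fact (B)** (sorry-free): `exists_dualSpheres_middleLevel_of_two_three`
at universe `0`, `X₁ = S⁴` (compact: Mathlib; simply connected: `simplyConnectedSpace_sphere_four_holds`),
`X₂ = M`, forgetting the level-embedding clause.
[cite: KirbyCorks1996, §2 (last paragraph) and §1] [cite: Matveyev1996, Proof of Theorem, sentences 1–6] -/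
theorem stub_middleLevel_fromSphere_of_fact (hB : exists_dualSpheres_middleLevel_of_two_three.{0}) :
    Sig.stub_middleLevel_fromSphere := by
  intro M _ _ _ _ _ _ _ c f hc hf h23
  haveI : SimplyConnectedSpace 𝕊⁴ := simplyConnectedSpace_sphere_four_holds
  obtain ⟨N, i₁, i₂, i₃, i₄, i₅, i₆, i₇, oN, oS, oP, k, S, P, -, hD, hP, hS⟩ := hB 𝕊⁴ M c f hc hf h23
  exact ⟨N, i₁, i₂, i₃, i₄, i₅, i₆, i₇, oN, oS, oP, k, S, P, hD, hP, hS⟩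

/-! ### Composition: the two stubs prove the crux BY NAME -/

/-- **The line closes the crux modulo the two registered stubs** (sorry-free; the glue is the PROVED
part of Smale's chain): `M` is compact (Hatcher 3.29, `compactSpace_of_homotopyEquiv_sphere_four_holds`)
and simply connected (`π₁(S⁴) = 1` transported along `e`); stub 1 gives an h-cobordism `S⁴ ~ M`;
trade handles to a two-three handlebody (`exists_isMorseFunction_two_three_of_isHCobordism_holds`,
PROVED: Milnor Thm. 8.1 + Thm. 4.8); stub 2 reads the presentation off the middle level. [bookkeeping] -/
theorem SpherePresentation_of :
    Sig.stub_thetaFour_bare → Sig.stub_middleLevel_fromSphere →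
      Summit.SmoothPoincare4.SmoothPoincare4.Theses.ThreePointSpheres.SpherePresentation := by
  intro hΘ hB M _ _ _ _ _ e
  haveI : CompactSpace M := compactSpace_of_homotopyEquiv_sphere_four_holds M e
  haveI : SimplyConnectedSpace 𝕊⁴ := simplyConnectedSpace_sphere_four_holds
  haveI : SimplyConnectedSpace M :=
    simplyConnectedSpace_of_homotopyEquiv_sphere_four simplyConnectedSpace_sphere_four_holds M e
  obtain ⟨c, hc⟩ := hΘ M e
  obtain ⟨f, hf, h23, -⟩ := exists_isMorseFunction_two_three_of_isHCobordism_holds 𝕊⁴ M c hc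
  exact hB M c f hc hf h23

/-- The skeleton in its final shape: the crux BY NAME from the two registered stubs (it becomes the
crux proof when the last `stub_*` is discharged; until then it depends on `sorryAx` through the stubs
only — no `sorry` of its own). [bookkeeping] -/
theorem SpherePresentation_proof :
    Summit.SmoothPoincare4.SmoothPoincare4.Theses.ThreePointSpheres.SpherePresentation :=
  SpherePresentation_of sig_stub_thetaFour_bare sig_stub_middleLevel_fromSphere

end Summit.SmoothPoincare4.SmoothPoincare4.Cruxes.SpherePresentation.Birth

end
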